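import Summits.SmoothPoincare4.SmoothPoincare4.Theorems.CylinderEntropyRungTwoOfSurgeryResolution
import HarnessLib

/-!
# Crux `CylinderEntropy.CylinderRungTwo` (stmt-SmoothPoincare4-7631) — CHECKED SKELETON, ALTERNATIVE line `reifenberg-recognition`

Crux-strategist s2 (planner, 2026-08-17).  Registered ALONGSIDE the lead's live skeleton `Lines/killing_flux.lean` (r21; never
touched).  Same surgery spine (split piece X₁ = item stmt-SmoothPoincare4-18045 BY NAME), but the RECOGNITION HALF is cut
differently: instead of the cite-only published fact `ChodoshMantoulidisSchulze2025_cor15b_four` (no `_holds`, never landable) and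
the computational kernel certificates `certMid`, the immortal leaves of the surgery tree are recognised by three CMS-free,
certificate-free statements in the entropy-near-one regime — the `reifenberg-stopping` mechanism (crux idea of the sibling crux
stmt-SmoothPoincare4-7632, triage PASS r1-1, never planned into a line before):

* `stub_entropyFlatness` (K1) — separating cross-sections with `λ_cyl ≤ 1 + ε` are two-sided `δ`-Reifenberg flat w.r.t. affine
  4-planes of `ℝ⁶` at all scales `≤ ρ(δ)` [cite: arXiv:2003.07480, Thm. 1.4 (Euclidean model statement)];
* `stub_slabConfinement` (K3) — … and lie in a slab `|z₅ - t₀| ≤ η(ε)` whose central slice is `η`-close to them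
  [cite: arXiv:1608.02314, Thm. 1.1 (Euclidean analogue: Hausdorff stability of the round sphere)];
* `stub_smoothReifenbergRecognition` (K2, THE LEVER) — a compact connected simply connected smooth cross-section that is
  `δ₀`-flat below `r₀` and `η₀(r₀)`-close to a slice is DIFFEOMORPHIC to `S⁴` (Reifenberg's tower started from the slice and
  STOPPED at the embedding's own `C¹` scale; every step is a normal-graph diffeomorphism between smooth closed models)
  [cite: CheegerColding1997, App. A, Thm. A.1.2–A.1.3] [cite: DavidToro2012, Thm. 2.15, Prop. 5.4].

Composition (sorry-free, this file): K1 ∧ K2 ∧ K3 ⇒ `sepNearSliceRecognition` (near-slice recognition WITH the separation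
hypothesis — weaker than item 18046 `NearSliceRecognition`, which has none) ⇒ `immortalLeafRecognition` (via the LANDED
relaxation `stub_relaxationOfAreaToFloor stub_hamiltonMonotonicity areaToFloor`: immortal leaves separate the ends, so the
separation hypothesis is available — this is the one observation that lets K1–K3 replace Cor. 1.5 (b)) ⇒ with X₁ and the LANDED
`resolvable_of_surgeryResolution` / `helper_cylNeckSurgeryTopology`: `CylinderRungTwo_of : CylinderEntropy.CylinderRungTwo` BY NAME.

Exactly four `sorry`s, all inside `stub_*`.  Hardest stub: `stub_surgeryResolution` (= item 18045, research-level port, shared with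
the live line); hardest NEW stub: `stub_entropyFlatness` (GMT compactness / local regularity at small scales).
-/

noncomputable section

set_option linter.dupNamespace false

open MeasureTheory Set Function
open scoped Manifold ContDiff ENNReal Topology BigOperators

namespace Summit.SmoothPoincare4.SmoothPoincare4.Cruxes.CylinderRungTwo.ReifenbergRecognition

open Literature.Geometry.Riemannian
open Literature.Geometry.Riemannian.SphericalCylinderEntropy (cylEntropy)
open Literature.Topology.FourManifolds
open Summit.SmoothPoincare4.SmoothPoincare4.Theses.CylinderEntropy
open Summit.SmoothPoincare4.SmoothPoincare4.Cruxes.CylinderRungTwo.KillingFlux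

/-! ## The four registered stubs -/

/-- STUB 1 · SURGERY RESOLUTION = route item `CylinderSurgeryResolution` (stmt-SmoothPoincare4-18045, split piece X₁) BY NAME:
every thin (`λ_cyl < 4/e`) end-separating cross-section of a compact connected `M` has a slice in every predicate closed under the
six surgery-tree rules.  Shared with the live line (`stub_cylinderSurgeryFlowOrNull ⇐ 18045`, p151490); research-level
(generic MCF + neck surgery re-run in `S⁴ × ℝ`).  Why plausibly true: CMS genericity and Daniels-Holgate surgery are local in
space-time and `N` has bounded geometry.  [size XL; the crux's residual research content]
[cite: ChodoshMantoulidisSchulze2025, Thm. 1.13] [cite: DanielsHolgate2022, Thm. 1.3, Def. 2.18–2.20] -/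
theorem stub_surgeryResolution : CylinderSurgeryResolution := by
  sorry

/-- STUB 2 · ENTROPY FLATNESS (K1).  For every `δ > 0` there are `ε, ρ > 0` such that every compact connected smooth
cross-section `ι : P ↪ N = S⁴ × ℝ ⊂ ℝ⁶` separating the ends with typed cylinder entropy `≤ 1 + ε` is TWO-SIDED `δ`-Reifenberg
flat with respect to affine 4-planes of `ℝ⁶` at every centre `ι x` and every scale `0 < r ≤ ρ`.  (Necessarily `ρ ≲ δ`: the
slice itself deviates from its tangent plane by `r²/2` at scale `r`.)  Euclidean model statement: L. Chen 2021, Thm. 1.4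
(`λ < 1 + δ ⇒ (ε, R)`-Reifenberg flat for every `R`), proved there with White's local regularity along the flow; claimed here only
below a small uniform scale, where `N` is `C²`-close to `ℝ⁵` and the cylinder kernel is two-sidedly comparable to the Euclidean
one.  Why it might fail: only through the proof, not the statement — fine wrinkles of slope `√(2ε)` are admissible at every scale
(drefute g2 on 7632), so `δ(ε) ≳ √ε` and NO `C¹` conclusion may be drawn; a flow-free proof needs a lower area bound at the
blow-up scale (BV compactness of the enclosed region + rigidity of entropy-one Caccioppoli sets), else port Chen's local flow
argument in normal charts.  [size XL] [cite: arXiv:2003.07480, Thm. 1.4 and Prop. 4.1] [cite: White2005, Thm. 3.1] -/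
theorem stub_entropyFlatness :
    ∀ δ : ℝ, 0 < δ → ∃ ε ρ : ℝ, 0 < ε ∧ 0 < ρ ∧
      ∀ (P : Type) [TopologicalSpace P] [T2Space P] [SecondCountableTopology P]
        [ChartedSpace (EuclideanSpace ℝ (Fin 4)) P] [IsManifold (𝓡 4) ∞ P] [CompactSpace P] [ConnectedSpace P]
        (ι : P → EuclideanSpace ℝ (Fin 6)), Manifold.IsSmoothEmbedding (𝓡 4) (𝓡 6) ∞ ι →
        (∀ x, ∑ i : Fin 5, ι x (Fin.castSucc i) ^ 2 = 1) → SeparatesEnds (Set.range ι) →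
        cylEntropy (Set.range ι) ≤ ENNReal.ofReal (1 + ε) →
        ∀ x : P, ∀ r : ℝ, 0 < r → r ≤ ρ →
          ∃ L : Submodule ℝ (EuclideanSpace ℝ (Fin 6)), Module.finrank ℝ L = 4 ∧
            (∀ y : P, dist (ι y) (ι x) ≤ r → ∃ w ∈ L, dist (ι y) (ι x + w) ≤ δ * r) ∧
            (∀ w ∈ L, ‖w‖ ≤ r → ∃ y : P, dist (ι y) (ι x + w) ≤ δ * r) := by
  sorry

/-- STUB 3 · SLAB CONFINEMENT / NEAR-SLICE (K3).  For every `η > 0` there is `ε > 0` such that every compact connected smooth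
end-separating cross-section with `λ_cyl ≤ 1 + ε` lies in a slab `|z₅ - t₀| ≤ η`, and every point of the slice `S⁴ × {t₀}` is
`η`-close to it (the second clause is elementary from the first and separation: every vertical line meets the cross-section).
Survived two disprover generations on crux 7632 as typed (`ε(η) ≲ 0.2 η²` necessary: polar-steepened terraces).  Area budget
`V ≤ μH⁴(range ι) ≤ (1+ε)V` (tree: `measure_ratio_le_cylEntropy`, shadow bound) + coarea in the height + isoperimetry on the
slices + a lower density bound at one scale; or Hamilton monotonicity + White regularity + height drift along the flow in `N`.
Why it might fail: W^{1,2} ↛ L^∞ in dimension 4 — spikes must be excluded at their own scale (tubes cost `λ(S³ × ℝ) ≈ 1.45`),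
which is where the lower density / flatness input of K1 is consumed.  [size L] [cite: arXiv:1608.02314, Thm. 1.1]
[cite: arXiv:1704.08900, Thm. 1.1] [cite: Hamilton1993, Thm. 4.1] -/
theorem stub_slabConfinement :
    ∀ η : ℝ, 0 < η → ∃ ε : ℝ, 0 < ε ∧
      ∀ (P : Type) [TopologicalSpace P] [T2Space P] [SecondCountableTopology P]
        [ChartedSpace (EuclideanSpace ℝ (Fin 4)) P] [IsManifold (𝓡 4) ∞ P] [CompactSpace P] [ConnectedSpace P]
        (ι : P → EuclideanSpace ℝ (Fin 6)), Manifold.IsSmoothEmbedding (𝓡 4) (𝓡 6) ∞ ι →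
        (∀ x, ∑ i : Fin 5, ι x (Fin.castSucc i) ^ 2 = 1) → SeparatesEnds (Set.range ι) →
        cylEntropy (Set.range ι) ≤ ENNReal.ofReal (1 + ε) →
        ∃ t₀ : ℝ, (∀ x : P, |ι x 5 - t₀| ≤ η) ∧
          ∀ q : EuclideanSpace ℝ (Fin 6), ∑ i : Fin 5, q (Fin.castSucc i) ^ 2 = 1 → q 5 = t₀ →
            ∃ x : P, dist (ι x) q ≤ η := by
  sorry

/-- STUB 4 · SMOOTH REIFENBERG RECOGNITION (K2) — THE LEVER.  There is a universal `δ₀ > 0` such that for every scale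
`r₀ > 0` there is `η₀ > 0` (think `η₀ = c δ₀ r₀`) with: every compact connected simply connected smooth end-separating
cross-section `ι : P ↪ N` whose image is two-sided `δ₀`-Reifenberg flat at all scales `≤ r₀` and `η₀`-Hausdorff close to a
slice `S⁴ × {t₀}` is DIFFEOMORPHIC to the standard `S⁴`.  Mechanism: Reifenberg's multiscale parametrisation started from the
slice (the scale-`r₀` model) — at each dyadic scale the smooth models built from the approximating planes are `C¹`-close at
their own scale, hence diffeomorphic by normal projection — STOPPED at the (`P`-dependent, but for each fixed `P` positive) scale
below which `range ι` is a `C¹`-small graph over its tangent planes, where the last model is diffeomorphic to `P`.  Flatness,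
not graphicality, is the hypothesis: the O(4)-symmetric double log-spiral cross-sections (triage F1 on 7632: tangent planes of
every inclination, `λ_cyl ≈ 1 + 1/(2c²)`) are `O(1/c)`-flat at every scale and are handled.  The homotopy type is not used.
Why it might fail: the quantifier shape — `η₀` must be allowed to depend on `r₀` (for `r₀ > 2δ₀` the hypothesis is vacuous
since the slice is not `δ₀`-flat at scale `r₀`); as typed it is.  [size XL (no tubular neighbourhoods / normal-graph lemma in
Mathlib)] [cite: CheegerColding1997, App. A, Thm. A.1.2 (vi), A.1.3] [cite: DavidToro2012, Thm. 2.15, Prop. 5.4]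
[cite: Reifenberg1960, Thm. 4] -/
theorem stub_smoothReifenbergRecognition :
    ∃ δ₀ : ℝ, 0 < δ₀ ∧ ∀ r₀ : ℝ, 0 < r₀ → ∃ η₀ : ℝ, 0 < η₀ ∧
      ∀ (P : Type) [TopologicalSpace P] [T2Space P] [SecondCountableTopology P]
        [ChartedSpace (EuclideanSpace ℝ (Fin 4)) P] [IsManifold (𝓡 4) ∞ P] [CompactSpace P] [ConnectedSpace P],
        SimplyConnectedSpace P →
        ∀ (ι : P → EuclideanSpace ℝ (Fin 6)), Manifold.IsSmoothEmbedding (𝓡 4) (𝓡 6) ∞ ι →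
        (∀ x, ∑ i : Fin 5, ι x (Fin.castSucc i) ^ 2 = 1) → SeparatesEnds (Set.range ι) →
        (∀ x : P, ∀ r : ℝ, 0 < r → r ≤ r₀ →
          ∃ L : Submodule ℝ (EuclideanSpace ℝ (Fin 6)), Module.finrank ℝ L = 4 ∧
            (∀ y : P, dist (ι y) (ι x) ≤ r → ∃ w ∈ L, dist (ι y) (ι x + w) ≤ δ₀ * r) ∧
            (∀ w ∈ L, ‖w‖ ≤ r → ∃ y : P, dist (ι y) (ι x + w) ≤ δ₀ * r)) →
        (∃ t₀ : ℝ, (∀ x : P, |ι x 5 - t₀| ≤ η₀) ∧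
          ∀ q : EuclideanSpace ℝ (Fin 6), ∑ i : Fin 5, q (Fin.castSucc i) ^ 2 = 1 → q 5 = t₀ →
            ∃ x : P, dist (ι x) q ≤ η₀) →
        Nonempty (P ≃ₘ⟮𝓡 4, 𝓡 4⟯ Metric.sphere (0 : EuclideanSpace ℝ (Fin 5)) 1) := by
  sorry

/-! ## The composition (no `sorry` below this line) -/

/-- **K1 ∧ K3 ∧ K2 ⇒ near-slice recognition of SEPARATING cross-sections** (the `ε`-bookkeeping "FlatSandwichTransfer"):
`δ₀` from K2; `ε₁, ρ` from K1 at `δ₀`; `η₀` from K2 at `r₀ := ρ`; `ε₂` from K3 at `η₀`; `ε := min ε₁ ε₂`. [folklore] -/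
theorem sepNearSliceRecognition :
    ∃ ε : ℝ, 0 < ε ∧
      ∀ (P : Type) [TopologicalSpace P] [T2Space P] [SecondCountableTopology P]
        [ChartedSpace (EuclideanSpace ℝ (Fin 4)) P] [IsManifold (𝓡 4) ∞ P] [CompactSpace P] [ConnectedSpace P],
        SimplyConnectedSpace P →
        ∀ (ι : P → EuclideanSpace ℝ (Fin 6)), Manifold.IsSmoothEmbedding (𝓡 4) (𝓡 6) ∞ ι →
        (∀ x, ∑ i : Fin 5, ι x (Fin.castSucc i) ^ 2 = 1) → SeparatesEnds (Set.range ι) →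
        cylEntropy (Set.range ι) < ENNReal.ofReal (1 + ε) →
        Nonempty (P ≃ₘ⟮𝓡 4, 𝓡 4⟯ Metric.sphere (0 : EuclideanSpace ℝ (Fin 5)) 1) := by
  obtain ⟨δ₀, hδ₀, hK2⟩ := stub_smoothReifenbergRecognition
  obtain ⟨ε₁, ρ, hε₁, hρ, hK1⟩ := stub_entropyFlatness δ₀ hδ₀
  obtain ⟨η₀, hη₀, hrec⟩ := hK2 ρ hρ
  obtain ⟨ε₂, hε₂, hK3⟩ := stub_slabConfinement η₀ hη₀
  refine ⟨min ε₁ ε₂, lt_min hε₁ hε₂, ?_⟩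
  intro P _ _ _ _ _ _ _ hsc ι hι hN hsep hent
  have hent₁ : cylEntropy (Set.range ι) ≤ ENNReal.ofReal (1 + ε₁) :=
    hent.le.trans (ENNReal.ofReal_le_ofReal (by linarith [min_le_left ε₁ ε₂]))
  have hent₂ : cylEntropy (Set.range ι) ≤ ENNReal.ofReal (1 + ε₂) :=
    hent.le.trans (ENNReal.ofReal_le_ofReal (by linarith [min_le_right ε₁ ε₂]))
  exact hrec P hsc ι hι hN hsep (hK1 P ι hι hN hsep hent₁) (hK3 P ι hι hN hsep hent₂)

/-- **Immortal leaves are recognised** — the exact hypothesis consumed by the landed `helper_cylNeckSurgeryTopology`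
(type of `immortalLeafRecognition_of_nearSlice _`), but derived from `sepNearSliceRecognition` instead of item 18046: by the
PROVED immortal half `areaToFloor` (item 17197), Hamilton's monotonicity and the relaxation glue (all landed), some late slice
has `λ_cyl < 1 + ε`; it separates the ends because every slice of an immortal leaf does. [cite: Hamilton1993, Thm. 4.1] -/
theorem immortalLeafRecognition :
    ∀ (P : Type) [TopologicalSpace P] [T2Space P] [SecondCountableTopology P]
      [ChartedSpace (EuclideanSpace ℝ (Fin 4)) P] [IsManifold (𝓡 4) ∞ P] [CompactSpace P] [ConnectedSpace P],
      SimplyConnectedSpace P →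
      ∀ (F : ℝ → P → EuclideanSpace ℝ (Fin 6)) (ν : ℝ → P → EuclideanSpace ℝ (Fin 6)) (T : ℝ),
      IsCylinderMCF P F ν T →
      (∀ t, T ≤ t → SeparatesEnds (Set.range (F t))) →
      (∀ t, T ≤ t → Literature.Geometry.Riemannian.SphericalCylinderEntropy.cylEntropy (Set.range (F t)) < 2) →
      Nonempty (P ≃ₘ⟮𝓡 4, 𝓡 4⟯ Metric.sphere (0 : EuclideanSpace ℝ (Fin 5)) 1) := by
  obtain ⟨ε, hε, hrec⟩ := sepNearSliceRecognition
  intro P _ _ _ _ _ _ _ hsc F ν T hflow hsep hent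
  obtain ⟨t₀, hTt₀, hsmall⟩ :=
    stub_relaxationOfAreaToFloor stub_hamiltonMonotonicity areaToFloor P F ν T hflow hsep hent ε hε
  exact hrec P hsc (F t₀) (hflow.isSmoothEmbedding t₀ hTt₀) (hflow.mem_cyl t₀ hTt₀) (hsep t₀ hTt₀) (hsmall t₀ le_rfl)

/-- **THE COMPOSITION — `CylinderEntropy.CylinderRungTwo` (route decl, BY NAME) from the four registered stubs.**
A homotopy 4-sphere is compact, connected and simply connected (tree facts); STUB 1 resolves a slice of it
(`resolvable_of_surgeryResolution`, landed); the immortal leaves of the surgery tree are recognised by K1–K3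
(`immortalLeafRecognition` above); the topology of the surgery tree (`helper_cylNeckSurgeryTopology`, landed: Daniels-Holgate
backward induction + Kervaire–Milnor) gives `M ≅ S⁴`.
[cite: DanielsHolgate2022, Thm. 1.3 and proof of Thm. 6.4] [cite: KervaireMilnorAnnals1963, Thm. 1.1] -/
theorem CylinderRungTwo_of : Summit.SmoothPoincare4.SmoothPoincare4.Theses.CylinderEntropy.CylinderRungTwo := by
  intro M _ _ _ _ _ e ι hι hN hsep hent
  haveI : CompactSpace M :=
    Literature.Topology.FourManifolds.compactSpace_of_homotopyEquiv_sphere_four_holds M e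
  haveI : PathConnectedSpace M := by
    haveI := Literature.Topology.FourManifolds.pathConnectedSpace_sphere_four
    exact Literature.Topology.FourManifolds.pathConnectedSpace_of_homotopyEquiv e
  have hsc : SimplyConnectedSpace M :=
    Literature.Topology.FourManifolds.simplyConnectedSpace_of_homotopyEquiv_sphere_four
      Literature.Topology.FourManifolds.simplyConnectedSpace_sphere_four_holds M e
  obtain ⟨κ, hres⟩ := resolvable_of_surgeryResolution stub_surgeryResolution M ι hι hN hsep hent
  exact helper_cylNeckSurgeryTopology immortalLeafRecognition M κ hres hsc

/-- Hypothesis-style cross-check: the NEW half alone closes item 18046's rôle for SEPARATING sections and hence, with item 18045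
as a hypothesis, the crux — i.e. the crux is `CylinderSurgeryResolution`-conditional exactly as on the live line, but with the
published CMS fact and the kernel certificates replaced by K1–K3. [folklore] -/
theorem cylinderRungTwo_of_surgeryResolution (hX₁ : CylinderSurgeryResolution) :
    Summit.SmoothPoincare4.SmoothPoincare4.Theses.CylinderEntropy.CylinderRungTwo := by
  intro M _ _ _ _ _ e ι hι hN hsep hent
  haveI : CompactSpace M :=
    Literature.Topology.FourManifolds.compactSpace_of_homotopyEquiv_sphere_four_holds M e
  haveI : PathConnectedSpace M := by
    haveI := Literature.Topology.FourManifolds.pathConnectedSpace_sphere_four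
    exact Literature.Topology.FourManifolds.pathConnectedSpace_of_homotopyEquiv e
  have hsc : SimplyConnectedSpace M :=
    Literature.Topology.FourManifolds.simplyConnectedSpace_of_homotopyEquiv_sphere_four
      Literature.Topology.FourManifolds.simplyConnectedSpace_sphere_four_holds M e
  obtain ⟨κ, hres⟩ := resolvable_of_surgeryResolution hX₁ M ι hι hN hsep hent
  exact helper_cylNeckSurgeryTopology immortalLeafRecognition M κ hres hsc

end Summit.SmoothPoincare4.SmoothPoincare4.Cruxes.CylinderRungTwo.ReifenbergRecognition

end
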